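import Summits.BirchSwinnertonDyer.Rank1Residual.Additive.TameBranchAnalyticShaRankZero
import Summits.BirchSwinnertonDyer.Rank1Residual.Additive.TameBranchRatCharEqBinderFree
import HarnessLib

/-!
# THE ANALYTIC ORDER OF Ш IS THE CERTIFICATE — the (M) twin, rank 0, X4(M) ∩ {`ρ̄` onto}, EVERY odd
# `p` (`p = 3` included): Kato 17.4 (3) + a (B)-datum + GZK + modularity + **`p ∤ #Ш_an(E)`** ⟹
# `TameBranchRatCharEqAt W p`, `Ш(E/ℚ)[p^∞] = 0`, `ℓ = 1`, `BSD(E,p)`, and `char_Λ X(E/ℚ_∞) = (g)` for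
# the Kato element `ι g = u·ϖ·L^±_p(f♭, a_p, ω^{(p−1)/2}, T)` — NO `p`-adic certificate
# (cell `b2b-bsdres`, sub-cell additive-p2 = X3♯(G-ord)/X4♯(G-ord), gen 32; part 4)

HONEST FRAMING (cell `b2b-bsdres`, run/shared/lean/b2b/bsd-rank1-residual/, verbatim in every
file): the goal of the cell is to DELETE the COMBINATION-SHAPED residual classes of the
Birch–Swinnerton-Dyer formula for ALL analytic-rank `≤ 1` elliptic curves over `ℚ` — "full BSD
formula for every rank `≤ 1` curve in class `C`" assembled STRICTLY from published theorems — so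
that the rank-`≤ 1` remainder becomes exactly the CONSTRUCTION-SHAPED classes, which are TYPED
(missing-input `Prop`s), NOT attempted. This is not "finishing BSD". Sub-cell additive-p2: the
classes X3♯(G-ord) / X4♯(G-ord) are CONSTRUCTION-SHAPED and stay so; the (M) rows belong to
additive-p1 / n1011 (their producers, bricks and class predicates are consumed BY NAME, nothing
restated); labels / RESIDUAL-MAP marks UNCHANGED; nothing is booked. Theorems only; published inputs
are explicit binders: `hK` = Kato 2004 Thm. 17.4 (3) half-eigenspace reading (the `p`-power tower of
`E♭` is AUTOMATIC on (M): Wuthrich 2014 Lemma 20, n1011's `PotMult.towerSurj_twist_of_surj`), `hmodD` =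
BCDT, `hGZK`, `hmod`, and `LeadingTermClauses W p Dh` = Delbourgo 2002 (B) for a height datum
(supplied on (M) by n1011-p16's `Delbourgo2002.mainTheorem_potMult`; in print `ℓ_p = 1` for
`ord_p j < 0`). No definition, no named fact, no `sorry`.

## What and why

Part 2 (`TameBranchAnalyticShaRankZero`) settled the (G-ord, `e = 2`) big-image rows at rank 0 from
`p ∤ #Ш_an(E)` alone. The OTHER defect-2 cell is (M): `E = E♭ ⊗ χ_{p*}` with `E♭` MULTIPLICATIVE at `p`,
integral brick n1011-p17's `AdditivePotMult.isTorsion_and_exists_iota_eq_of_katoHalf`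
(`ι g = C(u·ϖ)·L^±_p(f♭, a_p, ω^{(p−1)/2}, T)`, `a_p = ±1`), tuple step gen 31 part 7a. THIS FILE:

* §1 `exists_rat_and_unit_constantCoeff_branchMult_eq` — the (M) dictionary at `T = 0`:
  `(ϖ·L^±_p(f♭, a_p))(0) = u·(L(E,1)/Ω_E)`, `u = a_p⁻¹` resp. `a_p⁻¹·c_∞(E)` a `p`-adic UNIT (the tree's
  calibration `CensusX41.relationAt`, clauses (B^±)(A^±_M): Birch × Pal × Gauss × the one-term measure),
  hence `v_p((ϖ·L^±)(0)) + 2·ord_p #E(ℚ)_tors = ord_p #Ш_an(E) + ord_p ∏c` at analytic rank `0`;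
* §2 `ClassX4M.charIdeal_eq_span_kato_of_shaAn_unit_rankZero` (core, per twist data / cyclotomic datum)
  and the HEADLINE **`ClassX4M.tameBranchRatCharEqAt_and_bsdp_of_katoHalf_of_shaAn_unit_rankZero`**:
  X4(M) ∩ {`ρ̄_{E,p}` onto}, EVERY odd `p`, `ord_{s=1} L(E,s) = 0`, a (B)-datum, and
  **`ord_p #Ш_an(E) ≤ 0`** ⟹ **`TameBranchRatCharEqAt W p`**, **`#Ш(E/ℚ)[p^∞] = 1`**, **`ord_p #Ш_an = 0`**,
  **`BSD(E,p)`**, and per datum `char_Λ X = (g)` for the Kato element (Delbourgo's main conjecture (M) at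
  the pair, integrally in E-normalisation) — no unit root, no branch value, no `(μ_an, λ_an)` column, no
  Tamagawa witness, no parity.

Census (EVIDENCE only, X4-2 / hyp_bits are rank-1 / (G-ord) tables; the rank-0 (M) rows are the X4-1
calibration cell, 674 rank-0 (M) pairs `N ≤ 3000`): every such pair with `ρ̄` onto and `p ∤ #Ш_an` is in
scope, `p = 3` included. Nothing booked; labels UNCHANGED.

References: Kato 2004 Thm. 17.4 (3) [Kato2004Asterisque]; Wuthrich 2014 Lemma 20 [Wuthrich2014];
Delbourgo 2002 Thm. (A), (B) p. 40, p. 39 [Delbourgo2002]; Mazur–Tate–Teitelbaum 1986 §I.8, §I.10,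
§I.13 [MazurTateTeitelbaum1986Invent]; Pal 2012 Thm. 3.2 [Pal2012]; Greenberg LNM 1716 §4
[GreenbergLNM1716]; Miller 2011 Def. 1.1 [Miller2011LMS]; gen 31 parts 7a/7b, gen 32 parts 1–2. -/

set_option autoImplicit false

noncomputable section

open scoped Classical MatrixGroups ModularForm NumberField

open CongruenceSubgroup IsDedekindDomain WeierstrassCurve NumberField
  Literature.NumberTheory.EllipticCurves
  Literature.NumberTheory.EllipticCurves.ModularForms
  Literature.NumberTheory.EllipticCurves.Rank1Residual
  Literature.NumberTheory.EllipticCurves.Rank1Residual.Typed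
  Literature.NumberTheory.EllipticCurves.Delbourgo2002
  Literature.NumberTheory.GaloisRepresentations
  Summit.BirchSwinnertonDyer.Rank1Residual.AdditivePotMult
  Summit.BirchSwinnertonDyer.Rank1Residual.X1.MuLambda
  Summit.BirchSwinnertonDyer.Rank1Residual.X1.RankOneParitySqueeze
  Summit.BirchSwinnertonDyer.Rank1Residual.X11a.LambdaNorm

namespace Summit.BirchSwinnertonDyer.Rank1Residual.Additive

/-! ### §1 The (M) dictionary at `T = 0` -/

namespace TameBranchAnalyticSha

variable {W : WeierstrassCurve ℚ} [W.IsElliptic] [W.IsGloballyMinimal] {p : ℕ} [hp : Fact p.Prime]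

/-- **(M): THE CONSTANT TERM OF `ϖ·L^±_p(f♭, a_p, ω^{(p−1)/2}, T)` IS `L(E,1)/Ω_E` UP TO A `p`-ADIC UNIT.**
`E = W` additive at the odd prime `p`, `C • V^{(p*)} = W` with `V = E♭` globally minimal and
MULTIPLICATIVE at `p`, `f` the newform of `V` with `a_p(f) = ap` (`= ±1`), `ϖ` the period ratio of the
parity of `(p−1)/2`. Then `L(E,1)/Ω_E = q ∈ ℚ` and `(ϖ·L^±_p(f, ap))(0) = u·q` with `u = ap⁻¹` resp.
`ap⁻¹·c_∞(E)`, `v_p(u) = 0`. The tree's calibration `CensusX41.relationAt`, clauses (B^±), (A^±_M).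
[cite: MazurTateTeitelbaum1986Invent, §I.8 (8.6), §I.10 (10.1), §I.13] [cite: Pal2012, Thm. 3.2] -/
theorem exists_rat_and_unit_constantCoeff_branchMult_eq (hmod : hasEntireLFunction_rat) (hp2 : p ≠ 2)
    (hadd : Addv W p) (V : WeierstrassCurve ℚ) [V.IsElliptic] [V.IsGloballyMinimal]
    (C : VariableChange ℚ) (hC : C • V.quadraticTwist ((-1 : ℚ) ^ (p / 2) * p) = W) (hV : Mult V p)
    {N : ℕ} [NeZero N] {f : CuspForm (Gamma0 N) 2} (hf : IsNewformOf V f) {ap : ℤ}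
    (hap : cuspCoeff f p = ap)
    (ϖ : ℚ) (hϖ : if Even (p / 2) then (ϖ : ℝ) * V.realPeriodRat = plusPeriod f
      else (ϖ : ℝ) * V.imaginaryPeriodRat = minusPeriod f) :
    ∃ (q : ℚ) (u : ℚ_[p]), u ≠ 0 ∧ u.valuation = 0 ∧
      W.entireLFunction 1 / (W.realPeriodRat : ℂ) = (q : ℂ) ∧
      PowerSeries.constantCoeff (PowerSeries.C (ϖ : ℚ_[p]) *
          (if Even (p / 2) then padicLFunctionPlusBranchMult f ((ap : ℤ) : ℚ_[p]) (p / 2)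
            else padicLFunctionMinusBranchMult f ((ap : ℤ) : ℚ_[p]) (p / 2))) = u * (q : ℚ_[p]) := by
  have hΩ : (W.realPeriodRat : ℂ) ≠ 0 := by exact_mod_cast W.realPeriodRat_pos_holds.ne'
  -- `ap = a_p(V) = ±1`
  have hapV : ap = V.LFunction p := by
    have e : ((ap : ℤ) : ℂ) = ((V.LFunction p : ℤ) : ℂ) := by rw [← hap, hf.2 p]
    exact_mod_cast e
  have hap1 : ap = 1 ∨ ap = -1 := by
    by_cases hs : V.HasSplitMultiplicativeReductionAtPrime p
    · left
      have e : ((ap : ℤ) : ℂ) = ((1 : ℤ) : ℂ) := by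
        rw [← hap, (hf.cuspCoeff_eq_one_and_sq_of_split hs).1, Int.cast_one]
      exact_mod_cast e
    · right
      have e : ((ap : ℤ) : ℂ) = ((-1 : ℤ) : ℂ) := by
        rw [← hap, (hf.cuspCoeff_eq_neg_one_and_dvd_of_nonsplit hV hs).1, Int.cast_neg, Int.cast_one]
      exact_mod_cast e
  have hap0 : ((ap : ℤ) : ℚ_[p]) ≠ 0 := by
    rcases hap1 with rfl | rfl <;> norm_num
  have hapv : (((ap : ℤ) : ℚ_[p]))⁻¹.valuation = 0 := by
    rw [Padic.valuation_inv, Padic.valuation_intCast, neg_eq_zero]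
    rcases hap1 with rfl | rfl <;> simp [padicValInt]
  have hrel := CensusX41.relationAt p hmod W V C f hadd (Or.inr hV) hf
  have hodd : p % 4 = 1 ∨ p % 4 = 3 := by
    obtain ⟨k, hk⟩ := hp.out.odd_of_ne_two hp2
    omega
  rcases hodd with h1 | h3
  · have heven : Even (p / 2) := ⟨p / 4, by omega⟩
    have hC' : C • V.quadraticTwist (p : ℚ) = W := by
      have e : ((-1 : ℚ) ^ (p / 2) * p) = (p : ℚ) := by rw [heven.neg_one_pow, one_mul]
      rw [e] at hC
      exact hC
    rw [if_pos heven] at hϖ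
    obtain ⟨hL, -, hA⟩ := hrel.1 h1 hC' ϖ hϖ
    refine ⟨ϖ * legendrePlusSymbolSum f p, (((ap : ℤ) : ℚ_[p]))⁻¹, inv_ne_zero hap0, hapv,
      by rw [hL, mul_div_cancel_right₀ _ hΩ], ?_⟩
    rw [if_pos heven, map_mul, PowerSeries.constantCoeff_C, hapV, hA hV]
    push_cast
    ring
  · have ho : Odd (p / 2) := ⟨p / 4, by omega⟩
    have hnot : ¬ Even (p / 2) := Nat.not_even_iff_odd.mpr ho
    have hC' : C • V.quadraticTwist (-(p : ℚ)) = W := by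
      have e : ((-1 : ℚ) ^ (p / 2) * p) = -(p : ℚ) := by rw [ho.neg_one_pow, neg_one_mul]
      rw [e] at hC
      exact hC
    rw [if_neg hnot] at hϖ
    obtain ⟨hL, -, hA⟩ := hrel.2 h3 hC' ϖ hϖ
    have hcP0 : ((W.baseChange ℝ).numRealComponents : ℚ_[p]) ≠ 0 := by
      exact_mod_cast (W.baseChange ℝ).numRealComponents_pos.ne'
    have hcv : ((W.baseChange ℝ).numRealComponents : ℚ_[p]).valuation = 0 := by
      rw [Padic.valuation_natCast, Nat.cast_eq_zero]
      unfold WeierstrassCurve.numRealComponents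
      split_ifs
      · exact padicValNat_primes hp2
      · simp
    refine ⟨ϖ * legendreMinusSymbolSum f p / ((W.baseChange ℝ).numRealComponents : ℚ),
      (((ap : ℤ) : ℚ_[p]))⁻¹ * ((W.baseChange ℝ).numRealComponents : ℚ_[p]),
      mul_ne_zero (inv_ne_zero hap0) hcP0,
      by rw [Padic.valuation_mul (inv_ne_zero hap0) hcP0, hapv, hcv, add_zero],
      by rw [hL, mul_div_cancel_right₀ _ hΩ], ?_⟩
    rw [if_neg hnot, map_mul, PowerSeries.constantCoeff_C, hapV, hA hV]
    push_cast
    field_simp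

/-- **(M), analytic rank 0: `v_p((ϖ·L^±_p(f♭, a_p))(0)) + 2·ord_p #E(ℚ)_tors = ord_p #Ш_an(E) + ord_p ∏c`**
(`#Ш_an = shaAn W = s ∈ ℚ`; `L(E,1) ≠ 0`; GZK for `E(ℚ)` finite, `Reg = 1`).
[cite: Miller2011LMS, §1 (arXiv:1010.2431 p. 3)] [cite: MazurTateTeitelbaum1986Invent, §I.8 (8.6), §I.10] -/
theorem valuation_constantCoeff_branchMult_add_eq_padicValRat_shaAn_add (hmod : hasEntireLFunction_rat)
    (hGZK : rank_eq_analyticRank_of_analyticRank_le_one) (hp2 : p ≠ 2) (hadd : Addv W p)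
    (hL : W.entireLFunction 1 ≠ 0) (V : WeierstrassCurve ℚ) [V.IsElliptic] [V.IsGloballyMinimal]
    (C : VariableChange ℚ) (hC : C • V.quadraticTwist ((-1 : ℚ) ^ (p / 2) * p) = W) (hV : Mult V p)
    {N : ℕ} [NeZero N] {f : CuspForm (Gamma0 N) 2} (hf : IsNewformOf V f) {ap : ℤ}
    (hap : cuspCoeff f p = ap)
    (ϖ : ℚ) (hϖ : if Even (p / 2) then (ϖ : ℝ) * V.realPeriodRat = plusPeriod f
      else (ϖ : ℝ) * V.imaginaryPeriodRat = minusPeriod f)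
    {s : ℚ} (hs : shaAn W = (s : ℂ)) :
    PowerSeries.constantCoeff (PowerSeries.C (ϖ : ℚ_[p]) *
        (if Even (p / 2) then padicLFunctionPlusBranchMult f ((ap : ℤ) : ℚ_[p]) (p / 2)
          else padicLFunctionMinusBranchMult f ((ap : ℤ) : ℚ_[p]) (p / 2))) ≠ 0 ∧
      (PowerSeries.constantCoeff (PowerSeries.C (ϖ : ℚ_[p]) *
          (if Even (p / 2) then padicLFunctionPlusBranchMult f ((ap : ℤ) : ℚ_[p]) (p / 2)
            else padicLFunctionMinusBranchMult f ((ap : ℤ) : ℚ_[p]) (p / 2)))).valuation +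
          2 * padicValNat p W.torsionOrder =
        padicValRat p s + padicValNat p W.tamagawaProduct := by
  have hΩ : (W.realPeriodRat : ℂ) ≠ 0 := by exact_mod_cast W.realPeriodRat_pos_holds.ne'
  obtain ⟨q, u, hu0, huv, hLq, hA⟩ :=
    exists_rat_and_unit_constantCoeff_branchMult_eq hmod hp2 hadd V C hC hV hf hap ϖ hϖ
  obtain ⟨-, hfin, -, hshaAn⟩ := Wuthrich2014.shaAn_eq_of_L_one_div_eq hGZK W hL hLq
  haveI := hfin
  have hq0 : q ≠ 0 := by
    intro h0
    apply hL
    have e : W.entireLFunction 1 = (q : ℂ) * (W.realPeriodRat : ℂ) := by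
      rw [← hLq, div_mul_cancel₀ _ hΩ]
    rw [e, h0, Rat.cast_zero, zero_mul]
  have hT : W.torsionOrder = Nat.card W.toAffine.Point := W.torsionOrder_eq_natCard_of_finite
  have hT0 : (Nat.card W.toAffine.Point : ℚ) ≠ 0 := by
    rw [← hT]; exact_mod_cast W.torsionOrder_pos_holds.ne'
  have hc0 : (W.tamagawaProduct : ℚ) ≠ 0 := by
    exact_mod_cast (W.tamagawaProduct_pos_holds : 0 < W.tamagawaProduct).ne'
  have hs' : s = q * (Nat.card W.toAffine.Point : ℚ) ^ 2 / (W.tamagawaProduct : ℚ) := by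
    exact_mod_cast hs.symm.trans hshaAn
  refine ⟨by rw [hA]; exact mul_ne_zero hu0 (by exact_mod_cast hq0), ?_⟩
  rw [hA, Padic.valuation_mul hu0 (by exact_mod_cast hq0), huv, zero_add, Padic.valuation_ratCast, hs',
    padicValRat.div (mul_ne_zero hq0 (pow_ne_zero 2 hT0)) hc0, padicValRat.mul hq0 (pow_ne_zero 2 hT0),
    padicValRat.pow, padicValRat.of_nat, padicValRat.of_nat, hT]
  push_cast
  ring

end TameBranchAnalyticSha

/-! ### §2 X4(M) ∩ {`ρ̄` onto}, EVERY odd `p`: `p ∤ #Ш_an(E)` certifies the main conjecture at the pair -/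

section ClassLevelMult

open TameBranchMuPart TameBranchAnalyticSha

variable {W : WeierstrassCurve ℚ} [W.IsElliptic] [W.IsGloballyMinimal] {p : ℕ} [hp : Fact p.Prime]

/-- **THE CORE ON (M): `p ∤ #Ш_an(E)` ⟹ THE KATO ELEMENT GENERATES `char_Λ X(E/ℚ_∞)`.** X4(M) ∩
{`ρ̄_{E,p}` onto}, EVERY odd `p`, `ord_{s=1} L(E,s) = 0`, a (B)-datum `Dh`; `V = E♭` globally minimal
multiplicative at `p`, `C • V^{(p*)} = W`, `f` a newform of `V` with `a_p(f) = ap`, `ϖ` the period ratio of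
the parity of `(p−1)/2`; `#Ш_an(E) = s ∈ ℚ` with **`ord_p s ≤ 0`**. Then for every cyclotomic dual datum:
`X` torsion, **`#Ш(E/ℚ)[p^∞] = 1`**, **`ord_p s = 0`**, and a Kato element `g` with **`char_Λ X = (g)`**,
**`ι g = u·ϖ·L^±_p(f, ap, ω^{(p−1)/2}, T)`**, `u ∈ ℤ_p^×`, every generator having `μ = μ(g)`, `λ = λ(g)`.
[cite: Kato2004Asterisque, Thm. 17.4 (3) (p. 273)] [cite: Wuthrich2014, Lemma 20]
[cite: Delbourgo2002, Theorem (B) (p. 40), p. 39] [cite: GreenbergLNM1716, §4 pp. 102–110] -/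
theorem ClassX4M.charIdeal_eq_span_kato_of_shaAn_unit_rankZero
    (hK : Wuthrich2014.kato_halfEigenCharIdeal_dvd_cyclotomicPrime_of_surjective)
    (hGZK : rank_eq_analyticRank_of_analyticRank_le_one) (hmod : hasEntireLFunction_rat)
    (hX : ClassX4M W p) (hsurj : Surj W p) (hr : W.analyticRank = 0)
    {Dh : PAdicHeightData W p} (hBcl : LeadingTermClauses W p Dh)
    {s : ℚ} (hs : shaAn W = (s : ℂ)) (hsv : padicValRat p s ≤ 0)
    (V : WeierstrassCurve ℚ) [V.IsElliptic] [V.IsGloballyMinimal] (C : VariableChange ℚ)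
    (hC : C • V.quadraticTwist ((-1 : ℚ) ^ (p / 2) * p) = W) (hV : Mult V p)
    {N : ℕ} [NeZero N] {f : CuspForm (Gamma0 N) 2} (hf : IsNewformOf V f) {ap : ℤ}
    (hap : cuspCoeff f p = ap)
    (ϖ : ℚ) (hϖ : if Even (p / 2) then (ϖ : ℝ) * V.realPeriodRat = plusPeriod f
      else (ϖ : ℝ) * V.imaginaryPeriodRat = minusPeriod f)
    {κ : ZpExtension ℚ p} {γ : Field.absoluteGaloisGroup ℚ}
    (hκ : κ.IsCyclotomic) (hγ : κ.IsTopGenerator γ) (hγ' : IsCyclotomicVariable p γ)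
    (D : W.SelmerDualData κ γ) :
    D.IsTorsion ∧ Nat.card (AddCommGroup.primaryComponent W.sha p) = 1 ∧ padicValRat p s = 0 ∧
      ∃ (g : IwasawaAlgebra p) (u : ℤ_[p]ˣ), D.charIdeal = Ideal.span {g} ∧
        iwasawaToPowerSeries p g =
          PowerSeries.C (((u : ℤ_[p]) : ℚ_[p]) * (ϖ : ℚ_[p])) *
            (if Even (p / 2) then padicLFunctionPlusBranchMult f ((ap : ℤ) : ℚ_[p]) (p / 2)
              else padicLFunctionMinusBranchMult f ((ap : ℤ) : ℚ_[p]) (p / 2)) ∧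
        ∀ fE : IwasawaAlgebra p, D.charIdeal = Ideal.span {fE} → mu fE = mu g ∧ lam fE = lam g := by
  have hp2 : p ≠ 2 := hX.p_ne_two
  have hadd : Addv W p := hX.1.2.1
  obtain ⟨hmw, -⟩ := hGZK W (by rw [hr]; norm_num)
  have hr0 : W.mordellWeilRank = 0 := by rw [hmw, hr]
  have hL : W.entireLFunction 1 ≠ 0 := (W.analyticRank_eq_zero_iff_holds (hmod W)).mp hr
  have hsurjV : ∀ n : ℕ, V.HasSurjectiveModNGaloisRep (p ^ n : ℕ) :=
    (ClassX4M.potMult W p hX).towerSurj_twist_of_surj hp2 hsurj V C hC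
  haveI : Module.Finite (IwasawaAlgebra p) D.X :=
    SelmerDualData.module_finite_of_isCyclotomic (W := W) (κ := κ) hκ D hγ
  -- Kato's element on the (M) branch, `a_p = ±1` by cases
  have hbrick : D.IsTorsion ∧ ∃ g ∈ D.charIdeal, ∃ u : ℤ_[p]ˣ,
      iwasawaToPowerSeries p g = PowerSeries.C (((u : ℤ_[p]) : ℚ_[p]) * (ϖ : ℚ_[p])) *
        (if Even (p / 2) then padicLFunctionPlusBranchMult f ((ap : ℤ) : ℚ_[p]) (p / 2)
          else padicLFunctionMinusBranchMult f ((ap : ℤ) : ℚ_[p]) (p / 2)) := by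
    by_cases hsp : V.HasSplitMultiplicativeReductionAtPrime p
    · have hap1 : ap = 1 := by
        have e : ((ap : ℤ) : ℂ) = ((1 : ℤ) : ℂ) := by
          rw [← hap, (hf.cuspCoeff_eq_one_and_sq_of_split hsp).1, Int.cast_one]
        exact_mod_cast e
      subst hap1
      simpa only [Int.cast_one] using isTorsion_and_exists_iota_eq_of_katoHalf hK hp2 V C hC hsurjV hκ
        hγ hγ' hf D _ (Or.inr (Or.inl ⟨hsp, rfl⟩)) ϖ hϖ
    · have hap1 : ap = -1 := by
        have e : ((ap : ℤ) : ℂ) = ((-1 : ℤ) : ℂ) := by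
          rw [← hap, (hf.cuspCoeff_eq_neg_one_and_dvd_of_nonsplit hV hsp).1, Int.cast_neg, Int.cast_one]
        exact_mod_cast e
      subst hap1
      simpa only [Int.cast_neg, Int.cast_one] using isTorsion_and_exists_iota_eq_of_katoHalf hK hp2 V C
        hC hsurjV hκ hγ hγ' hf D _ (Or.inr (Or.inr ⟨hV, hsp, rfl⟩)) ϖ hϖ
  obtain ⟨hXt, g, hg, u, hι⟩ := hbrick
  -- the dictionary at `T = 0`
  obtain ⟨hϖB0, hdict⟩ := valuation_constantCoeff_branchMult_add_eq_padicValRat_shaAn_add hmod hGZK hp2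
    hadd hL V C hC hV hf hap ϖ hϖ hs
  have hX0eq : PowerSeries.constantCoeff (PowerSeries.C (((u : ℤ_[p]) : ℚ_[p]) * (ϖ : ℚ_[p])) *
      (if Even (p / 2) then padicLFunctionPlusBranchMult f ((ap : ℤ) : ℚ_[p]) (p / 2)
        else padicLFunctionMinusBranchMult f ((ap : ℤ) : ℚ_[p]) (p / 2))) =
      ((u : ℤ_[p]) : ℚ_[p]) * PowerSeries.constantCoeff (PowerSeries.C (ϖ : ℚ_[p]) *
        (if Even (p / 2) then padicLFunctionPlusBranchMult f ((ap : ℤ) : ℚ_[p]) (p / 2)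
          else padicLFunctionMinusBranchMult f ((ap : ℤ) : ℚ_[p]) (p / 2))) := by
    simp only [map_mul, PowerSeries.constantCoeff_C]
    ring
  have hX0 : PowerSeries.constantCoeff (PowerSeries.C (((u : ℤ_[p]) : ℚ_[p]) * (ϖ : ℚ_[p])) *
      (if Even (p / 2) then padicLFunctionPlusBranchMult f ((ap : ℤ) : ℚ_[p]) (p / 2)
        else padicLFunctionMinusBranchMult f ((ap : ℤ) : ℚ_[p]) (p / 2))) ≠ 0 := by
    rw [hX0eq]; exact mul_ne_zero (coe_units_ne_zero p u) hϖB0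
  have hvX : (PowerSeries.constantCoeff (PowerSeries.C (((u : ℤ_[p]) : ℚ_[p]) * (ϖ : ℚ_[p])) *
      (if Even (p / 2) then padicLFunctionPlusBranchMult f ((ap : ℤ) : ℚ_[p]) (p / 2)
        else padicLFunctionMinusBranchMult f ((ap : ℤ) : ℚ_[p]) (p / 2)))).valuation +
        2 * padicValNat p W.torsionOrder = padicValRat p s + padicValNat p W.tamagawaProduct := by
    rw [hX0eq, Padic.valuation_mul (coe_units_ne_zero p u) hϖB0, valuation_coe_units_eq_zero, zero_add,
      hdict]
  haveI : (Literature.NumberTheory.EllipticCurves.Module.charIdeal (IwasawaAlgebra p) D.X).IsPrincipal :=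
    charIdeal_isPrincipal_holds p D.X
  obtain ⟨fE, hchar⟩ := Submodule.IsPrincipal.principal
    (Literature.NumberTheory.EllipticCurves.Module.charIdeal (IwasawaAlgebra p) D.X)
  obtain ⟨hspan, -, -, hcard, -, -⟩ := fullSqueeze_rankZero_of_iota_eq hp2 hr0 hBcl hκ hγ hγ' D hXt
    hchar hg hι hX0 (by linarith)
  obtain ⟨-, ℓ, -, hle⟩ := padicValNat_tamagawa_le_valuation_rankZero_of_iota_eq hr0 hBcl hκ hγ hγ' D
    hXt hchar hg hι hX0
  have hs0 : padicValRat p s = 0 := by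
    have h1 : (0 : ℤ) ≤ padicValNat p (Nat.card (AddCommGroup.primaryComponent W.sha p)) := by
      exact_mod_cast Nat.zero_le _
    have h2 : (0 : ℤ) ≤ padicValNat p ℓ := by exact_mod_cast Nat.zero_le _
    linarith
  refine ⟨hXt, hcard, hs0, g, u, hspan, hι, fun fE' hchar' ↦ ?_⟩
  obtain ⟨-, hμ, hlam, -⟩ := fullSqueeze_rankZero_of_iota_eq hp2 hr0 hBcl hκ hγ hγ' D hXt hchar' hg hι
    hX0 (by linarith)
  exact ⟨hμ, hlam⟩

/-- **HEADLINE (M), RANK ZERO: THE ANALYTIC ORDER OF Ш IS THE CERTIFICATE.** X4(M) ∩ {`ρ̄_{E,p}` onto},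
EVERY odd `p` (`p = 3` included), `ord_{s=1} L(E,s) = 0`, a (B)-datum `Dh` (immaterial in rank 0;
`Delbourgo2002.mainTheorem_potMult`), and **`ord_p #Ш_an(E) ≤ 0`**. Then **`TameBranchRatCharEqAt W p`**
(cc-typer-2's typed rational main conjecture), **`#Ш(E/ℚ)[p^∞] = 1`**, **`ord_p #Ш_an(E) = 0`** and
**`BSD(E,p)`**. Inputs: Kato 17.4 (3) (`hK`), BCDT (`hmodD`), GZK, modularity, the (B)-datum — and ONE
INTEGER of Cremona's table. [cite: Kato2004Asterisque, Thm. 17.4 (3) (p. 273)] [cite: Wuthrich2014, Lemma 20]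
[cite: Delbourgo2002, Theorem (A), (B) (p. 40), p. 39] [cite: MazurTateTeitelbaum1986Invent, §I.8, §I.10, §I.13]
[cite: Miller2011LMS, Def. 1.1 (arXiv:1010.2431 p. 3)] -/
theorem ClassX4M.tameBranchRatCharEqAt_and_bsdp_of_katoHalf_of_shaAn_unit_rankZero
    (hK : Wuthrich2014.kato_halfEigenCharIdeal_dvd_cyclotomicPrime_of_surjective)
    (hmodD : nonempty_modularParametrizationData)
    (hGZK : rank_eq_analyticRank_of_analyticRank_le_one) (hmod : hasEntireLFunction_rat)
    (hX : ClassX4M W p) (hsurj : Surj W p) (hr : W.analyticRank = 0)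
    {Dh : PAdicHeightData W p} (hBcl : LeadingTermClauses W p Dh)
    {s : ℚ} (hs : shaAn W = (s : ℂ)) (hsv : padicValRat p s ≤ 0) :
    TameBranchRatCharEqAt W p ∧ Nat.card (AddCommGroup.primaryComponent W.sha p) = 1 ∧
      padicValRat p s = 0 ∧ BSDp W p := by
  have hp2 : p ≠ 2 := hX.p_ne_two
  obtain ⟨hmw, -⟩ := hGZK W (by rw [hr]; norm_num)
  have hL : W.entireLFunction 1 ≠ 0 := (W.analyticRank_eq_zero_iff_holds (hmod W)).mp hr
  obtain ⟨V, iV, iVm, C, hV, hC⟩ := hX.exists_mult_pStar_twist_model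
  haveI : NeZero (V.conductorNorm ℤ) := ⟨(V.conductorNorm_pos_holds).ne'⟩
  obtain ⟨Dm⟩ := hmodD V
  obtain ⟨ϖ, hϖ⟩ := exists_periodRatio_parity (p := p) V Dm
  obtain ⟨hap, -, -⟩ := cuspCoeff_eq_and_ne_zero_and_dvd_of_mult p Dm.isNewformOf hV
  have core := fun {κ : ZpExtension ℚ p} {γ : Field.absoluteGaloisGroup ℚ} (hκ : κ.IsCyclotomic)
      (hγ : κ.IsTopGenerator γ) (hγ' : IsCyclotomicVariable p γ) (D : W.SelmerDualData κ γ) ↦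
    ClassX4M.charIdeal_eq_span_kato_of_shaAn_unit_rankZero hK hGZK hmod hX hsurj hr hBcl hs hsv V C hC
      hV Dm.isNewformOf hap ϖ hϖ hκ hγ hγ' D
  obtain ⟨κ₀, γ₀, hκ₀, hγ₀, hγ₀', D₀, -, -⟩ := exists_cyclotomic_dualData_generator W p
  obtain ⟨-, hcard, hs0, -⟩ := core hκ₀ hγ₀ hγ₀' D₀
  obtain ⟨h0, -⟩ := valuation_constantCoeff_branchMult_add_eq_padicValRat_shaAn_add hmod hGZK hp2 hX.1.2.1
    hL V C hC hV Dm.isNewformOf hap ϖ hϖ hs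
  have hϖ0 : ϖ ≠ 0 := by
    rintro rfl; apply h0; rw [Rat.cast_zero, map_zero, zero_mul, map_zero]
  have hB0 : (if Even (p / 2) then padicLFunctionPlusBranchMult Dm.f ((V.LFunction p : ℤ) : ℚ_[p]) (p / 2)
      else padicLFunctionMinusBranchMult Dm.f ((V.LFunction p : ℤ) : ℚ_[p]) (p / 2)) ≠ 0 := by
    intro e; apply h0; rw [e, mul_zero, map_zero]
  refine ⟨?_, hcard, hs0, ⟨hmw, Nat.finite_of_card_ne_zero (by rw [hcard]; exact one_ne_zero), s, hs,
    by rw [hs0, hcard, padicValNat_one_right, Nat.cast_zero]⟩⟩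
  intro κ γ N _ f ε α B _ haddv _ hκ hγ hcv hf _ hα hB D
  obtain ⟨hXt, -, -, g₁, u, hspan, hι, -⟩ := core hκ hγ hcv D
  have hnd : ∃ r : ℚ, ratPlusSymbol f r ≠ 0 := by
    refine ⟨0, fun h00 ↦ hL ?_⟩
    rw [hf.entireLFunction_one_eq, h00]
    simp
  exact ⟨hXt, exists_charIdeal_eq_span_and_iota_eq_of_generator_mult hp2 V C hC haddv hV hf hnd Dm hap
    hϖ0 hspan hι hB0 hα hB⟩

end ClassLevelMult

end Summit.BirchSwinnertonDyer.Rank1Residual.Additive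

end
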